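import Literature.Analysis.FluidPDE.ElgindiProfileNontrivial
import Literature.Analysis.FluidPDE.ElgindiAprioriBlowupProofs
import Literature.Analysis.FluidPDE.DynamicRescalingBKM
import HarnessLib

/-!
# **ns.S29 (i)** from the stable modulated solution of Elgindi–Ghoul–Masmoudi read in physical
variables (the proved glue of the Elgindi–Ghoul–Masmoudi line)

Topic `Literature/Analysis/FluidPDE`. Proof file (everything proved; no named facts; no
definitions of mathematical content beyond the auxiliary extension `Elgindi.extendNonneg`) on the
path to the target **ns.S29 (i)** `Literature.Analysis.FluidPDE.elgindi_euler_blowup`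
(`Axisymmetric.lean`: the reviewed rendering of Elgindi–Ghoul–Masmoudi, Camb. J. Math. 9 (2021) =
arXiv:1910.14071, §1.3 Thm 1). It proves the passage which the source leaves to the reader (p. 9
of the held text: "the following stability theorem from which Theorem 1 and its Corollary
follow"; Remark 2.3) from

* the **self-similar data** of §2.3–2.6 for one small `α`: a profile `F` with `‖F − aF_*‖_{𝓗⁰} ≤ C₀α²`,
  `|a − 1| ≤ C₀α` (Elgindi's profile, [Elgindi2021] §9.5, as recalled in §2.3), a global
  swirl-free modulated solution `(W, Φ_W, λ, μ)` (`Elgindi.IsModulatedSolution`) with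
  `‖W(s) − F‖_{𝓗⁰} ≤ Ce^{−κs}` (§2.5 Thm 2 for the §2.6 datum) and `λ` integrable on `(0, ∞)`
  (Cor. 2.2: `T_* = ∫₀^∞ λ < ∞`) — all of which follow from the named fact
  `Elgindi.ElgindiGhoulMasmoudi2021_stabilityCore` and the discharged
  `Elgindi.ElgindiGhoulMasmoudi2021_compactSupportDatum` (`ElgindiStabilityDecomposition.lean`;
  packaged with `λ ∈ L¹(0, ∞)` as `Elgindi.stableModulatedSolution_of_core`,
  `ElgindiStableBlowupPhysical.lean`), and
* the **physical reading** of that solution (§2.1–2.3, p. 7–8: `R = ρ^α`,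
  `Ω(R, t, θ) = λ⁻¹W(μR/λ^{1+δ}, s, θ)`, `ds/dt = λ⁻¹`; §1.3 Thm 1, p. 3: "the unique local solution
  … belonging to the class `L² ∩ C^{1,α}_{x,t}`"; [Elgindi2021] §2, p. 8: "any `C^α` solution to
  (2.1) with sufficient decay at infinity and which vanishes on `r = 0` is a classical solution to
  the full 3D Euler system"): physical fields `(u₀, u, p)` forming a solution of the Hölder class
  `IsHolderEulerSolution α [0, T_*) u₀ u p` (`ElgindiBlowupContinuationProofs.lean`),
  `T_* = ∫₀^∞ λ`, with axisymmetric swirl-free slices, and the vorticity identity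
  `‖ω(t(s))‖_{L^∞} = λ(s)⁻¹ sup_{strip}|W(s)|`, `t(s) = ∫₀ˢ λ`,

to **ns.S29 (i)**. The mathematical content is the Beale–Kato–Majda divergence
`lim_{t ↑ T_*} ∫₀ᵗ ‖ω‖_∞ = ∞` of the physical vorticity, which uses *only* the self-similar data
and the vorticity identity (`Elgindi.bkmBlowup_of_physicalVorticity`, stated for any size
functional `N(t)` with `N(t(s)) = λ(s)⁻¹ sup|W(s)|`): (1) **non-triviality**
(`ElgindiProfileNontrivial.lean`): for `α ≤ 1`, `C₀α ≤ 1/2`, `C₀α ≤ √(π/6)/18` and `s ≥ s₀`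
(where `Ce^{−κs} ≤ (α/18)√(π/6)`), `sup_{strip}|W(s)| ≥ α/9`; (2) hence `λ(s)N(t(s)) ≥ α/9` for
`s ≥ s₀`, and the change of variables `∫₀^{t(τ)} N dt = ∫₀^τ λ(σ)N(t(σ)) dσ ≥ (α/9)(τ − s₀) → ∞`
(`tendsto_lintegral_Ioo_nhdsLT_blowupTime_of_eventually`, an "eventually" form of the lemma of
`DynamicRescalingBKM.lean`), i.e. `∫₀ᵗ N → ∞` as `t ↑ T_* = ∫₀^∞ λ` (`T_* > 0`, `blowupTime_pos`);
the modulation parameter, given on `s ≥ 0`, is extended constantly to `s < 0`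
(`Elgindi.extendNonneg`) to meet the hypotheses of those lemmas. With the Hölder class and the
symmetry of the slices, `elgindi_euler_blowup_of_bkmBlowupAt` (`ElgindiBlowupContinuation.lean`:
`limsup` form of the blow-up from the locally uniform `C^{1,α}` bounds, then the normalisation
`T_* ↦ 1` by `u ↦ T_* u(T_* t, x)`) gives the target: `elgindi_euler_blowup_of_physicalReading`
(one `α`, explicit hypotheses) and `elgindi_euler_blowup_of_stableBlowupPhysical` (hypotheses
packaged as printed — "there is `α₀` such that for all `α < α₀` …" (Thm 2), the constant `C₀` of
the profile independent of `α` (§2.3) — performing the choice of `α`, §1.7, p. 5: "`α` will be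
chosen at the end to be very small").

## History (D-0026) and the remaining obligation of ns.S29 (i)

Until the bad-split reviews of 2026-08-15 this glue ran through two intermediate named facts,
both decomposition children on the line to `elgindi_euler_blowup` and both since **merged back**
into its proof obligation (one unproved named fact per printed theorem; decompositions do not
recurse): `Elgindi.ElgindiGhoulMasmoudi2021_stableBlowupPhysical` (`ElgindiStableBlowupPhysical.lean`;
the stable modulated solution *conjoined with* its physical reading — its statement survives
verbatim as the hypothesis of `elgindi_euler_blowup_of_stableBlowupPhysical` below), and the
"blow-up solution in physical variables" formerly declared in `ElgindiAprioriBlowupProofs.lean`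
(the printed Theorem 1 at the blow-up time `T_*` of Cor. 2.2 with the clauses of the
construction, i.e. the target restated before the normalisation `T_* ↦ 1`, not a distinct
published result; the theorems of this file used to conclude it and now conclude the target, and
its statement survives as the hypothesis of `elgindi_euler_blowup_of_blowupSolution` there).

**Obligation of ns.S29 (i) after the merges**: `Elgindi.ElgindiGhoulMasmoudi2021_stabilityCore`
(named fact, XL: [Elgindi2021] §4–§9 and [ElgindiGhoulMasmoudi2021] §3–§7) ⟶ the self-similar
data for every small `α` (proved, `Elgindi.stableModulatedSolution_of_core`) ⟶ the physical
reading of that solution (to be formalised: the axisymmetric Biot–Savart law in the `(R, θ)`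
coordinates with `C^{1,α}` estimates up to the axis, the symmetry plane and the origin,
conservation of energy, transport of the vorticity support, a `C¹` pressure; printed regularity
steps [ElgindiGhoulMasmoudi2021] Lemma 9.1, `𝓗ᵏ ↪ L^∞`, p. 20, and [Elgindi2021] Cor. 8.2,
`𝓗² ↪ C^β`, p. 25) ⟶ this file (proved). This file imports neither end: its theorems take the
data as explicit hypotheses. Used: `lintegral_Ioo_rescaledTime`, `rescaledTime_lt_blowupTime`,
`blowupTime_pos` (`DynamicRescaling*.lean`), `Elgindi.ofReal_le_iSup_of_decay`
(`ElgindiProfileNontrivial.lean`), `IsHolderEulerSolution.bound_of_lt`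
(`ElgindiAprioriBlowupProofs.lean`), `elgindi_euler_blowup_of_bkmBlowupAt`
(`ElgindiBlowupContinuation.lean`). -/

noncomputable section

open MeasureTheory Set Function Filter TopologicalSpace Real
open _root_.Topology
open scoped ContDiff NNReal ENNReal

namespace Literature.Analysis.FluidPDE

/-- Local notation for physical space `ℝ³ = EuclideanSpace ℝ (Fin 3)`. -/
local notation "ℝ³" => EuclideanSpace ℝ (Fin 3)

/-! ### Beale–Kato–Majda divergence from an *eventual* rescaled lower bound -/

/-- **Linear growth of the BKM integral from an eventual lower bound.** If the rescaled size stays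
above `m` for `σ ≥ s₀ ≥ 0` — `m ≤ C(σ) N(t(σ))` — then `∫_{(0, t(τ))} N ≥ m (τ − s₀)` for `τ ≥ s₀`
(change of variables `dt = C dσ` and restriction to `(s₀, τ)`). [folklore] -/
theorem mul_le_lintegral_Ioo_rescaledTime_of_eventually {C : ℝ → ℝ} (hC : Continuous C)
    (hpos : ∀ τ, 0 < C τ) {N : ℝ → ℝ≥0∞} {m : ℝ≥0∞} {s₀ : ℝ} (hs₀ : 0 ≤ s₀)
    (hN : ∀ σ, s₀ ≤ σ → m ≤ ENNReal.ofReal (C σ) * N (rescaledTime C σ)) {τ : ℝ} (hτ : s₀ ≤ τ) :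
    m * ENNReal.ofReal (τ - s₀) ≤ ∫⁻ t in Ioo 0 (rescaledTime C τ), N t := by
  rw [lintegral_Ioo_rescaledTime hC hpos N (hs₀.trans hτ)]
  calc m * ENNReal.ofReal (τ - s₀) = ∫⁻ _σ in Ioo s₀ τ, m := by
        rw [setLIntegral_const, Real.volume_Ioo]
    _ ≤ ∫⁻ σ in Ioo s₀ τ, ENNReal.ofReal (C σ) * N (rescaledTime C σ) :=
        setLIntegral_mono' measurableSet_Ioo fun σ hσ => hN σ hσ.1.le
    _ ≤ ∫⁻ σ in Ioo 0 τ, ENNReal.ofReal (C σ) * N (rescaledTime C σ) :=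
        lintegral_mono_set (Ioo_subset_Ioo_left hs₀)

/-- **Blow-up in the printed Beale–Kato–Majda form from an eventual rescaled lower bound**
("eventually" form of `tendsto_lintegral_Ioo_nhdsLT_blowupTime`): `C` continuous, positive and
integrable on `(0, ∞)` (so `T = t(∞) < ∞`), and `m ≤ C(σ) N(t(σ))` for `σ ≥ s₀` with `m ≠ 0`; then
`∫_{(0,t)} N → ∞` as `t ↑ T`. [folklore] -/
theorem tendsto_lintegral_Ioo_nhdsLT_blowupTime_of_eventually {C : ℝ → ℝ} (hC : Continuous C)
    (hpos : ∀ τ, 0 < C τ) (hint : IntegrableOn C (Ioi 0)) {N : ℝ → ℝ≥0∞} {m : ℝ≥0∞} (hm : m ≠ 0)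
    {s₀ : ℝ} (hs₀ : 0 ≤ s₀)
    (hN : ∀ σ, s₀ ≤ σ → m ≤ ENNReal.ofReal (C σ) * N (rescaledTime C σ)) :
    Tendsto (fun t => ∫⁻ s in Ioo 0 t, N s) (𝓝[<] (blowupTime C)) (𝓝 ∞) := by
  rw [ENNReal.tendsto_nhds_top_iff_nnreal]
  intro M
  have h1 : Tendsto (fun x : ℝ => m * ENNReal.ofReal x) atTop (𝓝 (m * (⊤ : ℝ≥0∞))) :=
    ENNReal.Tendsto.const_mul ENNReal.tendsto_ofReal_atTop (Or.inl ENNReal.top_ne_zero)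
  rw [ENNReal.mul_top hm] at h1
  obtain ⟨x, hx0, hMx⟩ :=
    ((eventually_ge_atTop (0 : ℝ)).and (h1.eventually (lt_mem_nhds ENNReal.coe_lt_top))).exists
  have hτ : s₀ ≤ s₀ + x := le_add_of_nonneg_right hx0
  have hlt := rescaledTime_lt_blowupTime hC hpos hint (s₀ + x)
  filter_upwards [Ioo_mem_nhdsLT hlt] with t ht
  calc (M : ℝ≥0∞) < m * ENNReal.ofReal x := hMx
    _ = m * ENNReal.ofReal (s₀ + x - s₀) := by rw [add_sub_cancel_left]
    _ ≤ ∫⁻ s in Ioo 0 (rescaledTime C (s₀ + x)), N s :=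
        mul_le_lintegral_Ioo_rescaledTime_of_eventually hC hpos hs₀ hN hτ
    _ ≤ ∫⁻ s in Ioo 0 t, N s := lintegral_mono_set (Ioo_subset_Ioo_right ht.1.le)

/-! ### Extending the modulation parameter to negative rescaled times -/

namespace Elgindi

/-- Constant extension of a parameter given on `s ≥ 0` to all of `ℝ`: `λ̃(s) = λ(max(s, 0))`
(only `s ≥ 0` enters the physical time `t(s) = ∫₀ˢ λ` and `T_* = ∫₀^∞ λ`). [folklore] -/
def extendNonneg (lam : ℝ → ℝ) (s : ℝ) : ℝ :=
  lam (max s 0)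

/-- The extension agrees with the parameter on `s ≥ 0`. [folklore] -/
theorem extendNonneg_of_nonneg (lam : ℝ → ℝ) {s : ℝ} (hs : 0 ≤ s) : extendNonneg lam s = lam s := by
  simp [extendNonneg, max_eq_left hs]

/-- The extension of a parameter continuous on `[0, ∞)` is continuous. [folklore] -/
theorem continuous_extendNonneg {lam : ℝ → ℝ} (h : ContinuousOn lam (Ici 0)) :
    Continuous (extendNonneg lam) :=
  h.comp_continuous (continuous_id.max continuous_const) fun _ => Set.mem_Ici.2 (le_max_right _ _)

/-- The extension of a parameter positive on `[0, ∞)` is positive. [folklore] -/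
theorem extendNonneg_pos {lam : ℝ → ℝ} (h : ∀ s, 0 ≤ s → 0 < lam s) (s : ℝ) :
    0 < extendNonneg lam s :=
  h _ (le_max_right _ _)

/-- The physical time is unchanged: `t_{λ̃}(τ) = t_λ(τ)` for `τ ≥ 0`. [folklore] -/
theorem rescaledTime_extendNonneg (lam : ℝ → ℝ) {τ : ℝ} (hτ : 0 ≤ τ) :
    rescaledTime (extendNonneg lam) τ = rescaledTime lam τ := by
  simp only [rescaledTime_apply]
  refine intervalIntegral.integral_congr fun s hs => ?_
  rw [uIcc_of_le hτ] at hs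
  exact extendNonneg_of_nonneg lam hs.1

/-- The blow-up time is unchanged: `T_{λ̃} = T_λ`. [folklore] -/
theorem blowupTime_extendNonneg (lam : ℝ → ℝ) :
    blowupTime (extendNonneg lam) = blowupTime lam := by
  simp only [blowupTime_eq]
  exact setIntegral_congr_fun measurableSet_Ioi fun s hs => extendNonneg_of_nonneg lam (le_of_lt hs)

/-- Integrability on `(0, ∞)` is unchanged. [folklore] -/
theorem integrableOn_extendNonneg_iff (lam : ℝ → ℝ) :
    IntegrableOn (extendNonneg lam) (Ioi 0) ↔ IntegrableOn lam (Ioi 0) :=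
  integrableOn_congr_fun (fun _ hs => extendNonneg_of_nonneg lam (le_of_lt hs)) measurableSet_Ioi

/-- Exponentially decaying quantities are eventually small: `Ce^{−κs} ≤ ε` for `s ≥ s₀`, with
`s₀ ≥ 0`. [folklore] -/
theorem exists_forall_mul_exp_neg_le {κ : ℝ} (hκ : 0 < κ) (C : ℝ) {ε : ℝ} (hε : 0 < ε) :
    ∃ s₀ : ℝ, 0 ≤ s₀ ∧ ∀ s, s₀ ≤ s → C * Real.exp (-κ * s) ≤ ε := by
  have h1 : Tendsto (fun s : ℝ => Real.exp (-(κ * s))) atTop (𝓝 0) :=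
    Real.tendsto_exp_neg_atTop_nhds_zero.comp (tendsto_id.const_mul_atTop hκ)
  have h2 : Tendsto (fun s : ℝ => C * Real.exp (-κ * s)) atTop (𝓝 0) := by
    have := h1.const_mul C
    simpa only [mul_zero, neg_mul] using this
  obtain ⟨s₁, hs₁⟩ := eventually_atTop.1 (h2.eventually (Iic_mem_nhds hε))
  exact ⟨max s₁ 0, le_max_right _ _, fun s hs => hs₁ s ((le_max_left _ _).trans hs)⟩

/-! ### The Beale–Kato–Majda divergence of the physical vorticity -/

/-- **Beale–Kato–Majda blow-up at `T_* = ∫₀^∞ λ` of the physical vorticity of a stable modulated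
solution** (Elgindi–Ghoul–Masmoudi, Camb. J. Math. 9 (2021) = arXiv:1910.14071: §2.5 Thm 2 and
Cor 2.2 read in the physical variables of §2.1–2.3 ⟹ the blow-up clause of §1.3 Thm 1,
`lim_{t→T_*} ∫₀ᵗ |ω|_{L^∞} = ∞`; p. 9 of the held text: "the following stability theorem from which
Theorem 1 and its Corollary follow", Remark 2.3). Hypotheses: an exponent `0 < α ≤ 1` and a
constant `C₀ ≥ 0` with `C₀α ≤ 1/2`, `C₀α ≤ √(π/6)/18` (§1.7, p. 5: "`α` will be chosen at the end to
be very small"); a profile `(F, Φ_F)` (`Elgindi.IsProfile`) with an amplitude `a`,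
`|a − 1| ≤ C₀α`, `‖F − aF_*‖_{𝓗⁰} ≤ C₀α²` (§2.3, p. 7: "`F = F_* + α²g`, `|g|_{𝓗ᵏ} ≤ C`"); a
swirl-free modulated solution `(W, Φ_W, λ, μ)` (`Elgindi.IsModulatedSolution`, §2.3, p. 8) with
`‖W(s) − F‖_{𝓗⁰} ≤ Ce^{−κs}`, `κ > 0`, `C ≥ 0` (Thm 2, p. 9) and `λ` integrable on `(0, ∞)`
(Cor. 2.2: "there exists `T_*`"); and a size functional `N : ℝ → [0, ∞]` of the physical solution
obeying the **vorticity identity** `N(t(s)) = λ(s)⁻¹ sup_{strip}|W(s)|` for `s ≥ 0`,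
`t(s) = rescaledTime λ s = ∫₀ˢ λ` (for `N(t) = ‖curl u(t)‖_{L^∞}` this is the display
`Ω(R,t,θ) = λ⁻¹W(μR/λ^{1+δ}, s, θ)`, `ds/dt = λ⁻¹` of §2.3, p. 8, with `|ω| = |Ω|`). Conclusion:
`T_* = blowupTime λ = ∫₀^∞ λ > 0` and `∫_{(0,t)} N → ∞` as `t ↑ T_*`. Proof: `sup|W(s)| ≥ α/9` for
large `s` (`Elgindi.ofReal_le_iSup_of_decay`), hence `λ(s)N(t(s)) ≥ α/9`, integrated along
`dt = λ ds` up to `T_*` (`tendsto_lintegral_Ioo_nhdsLT_blowupTime_of_eventually`, `λ` extended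
constantly to `s < 0` by `Elgindi.extendNonneg`). [cite: ElgindiGhoulMasmoudi2021, §2.5 Thm 2, Cor 2.2 and Remark 2.3 (p. 9 of arXiv:1910.14071); §2.3 (p. 8); §1.3 Thm 1 (p. 3)] -/
theorem bkmBlowup_of_physicalVorticity {α C₀ : ℝ} (hα : 0 < α) (hα1 : α ≤ 1) (hC₀ : 0 ≤ C₀)
    (hC₀α : C₀ * α ≤ 1 / 2) (hsmall : C₀ * α ≤ Real.sqrt (π / 6) / 18)
    {δ : ℝ} {F ΦF : ℝ → ℝ → ℝ} {a : ℝ} (hprof : IsProfile α δ F ΦF) (ha : |a - 1| ≤ C₀ * α)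
    (hFa : eHkNorm α 0 (F - a • fundamentalProfile α) ≤ ENNReal.ofReal (C₀ * α ^ 2))
    {κ C : ℝ} (hκ : 0 < κ) (hC : 0 ≤ C) {W Φ : ℝ → ℝ → ℝ → ℝ} {lam mu : ℝ → ℝ}
    (hsol : IsModulatedSolution α δ W Φ lam mu)
    (hdecay : ∀ s, 0 ≤ s → eHkNorm α 0 (W s - F) ≤ ENNReal.ofReal (C * Real.exp (-κ * s)))
    (hint : IntegrableOn lam (Ioi 0)) {N : ℝ → ℝ≥0∞}
    (hN : ∀ s, 0 ≤ s → N (rescaledTime lam s) =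
      ENNReal.ofReal (lam s)⁻¹ * ⨆ q : strip, ‖W s q.1.1 q.1.2‖ₑ) :
    0 < blowupTime lam ∧
      Tendsto (fun t => ∫⁻ s in Ioo 0 t, N s) (𝓝[<] (blowupTime lam)) (𝓝 ∞) := by
  have hFcont : ContinuousOn (uncurry F) strip := hprof.contDiffOn.continuousOn
  -- (1) the extended modulation parameter and the blow-up time
  set lamE : ℝ → ℝ := extendNonneg lam with hlamE
  have hcontE : Continuous lamE := continuous_extendNonneg hsol.lam_continuousOn
  have hposE : ∀ s, 0 < lamE s := extendNonneg_pos hsol.lam_pos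
  have hintE : IntegrableOn lamE (Ioi 0) := (integrableOn_extendNonneg_iff lam).2 hint
  have hTE : blowupTime lamE = blowupTime lam := blowupTime_extendNonneg lam
  have hTpos : 0 < blowupTime lam := by
    rw [← hTE]
    exact blowupTime_pos hcontE hposE hintE
  -- (2) non-triviality for large rescaled times
  have hεpos : 0 < α / 18 * Real.sqrt (π / 6) := by positivity
  obtain ⟨s₀, hs₀, hsmallC⟩ := exists_forall_mul_exp_neg_le hκ C hεpos
  have hWcont : ∀ s, 0 ≤ s → ContinuousOn (uncurry (W s)) strip := fun s hs => by
    have hf : Continuous fun q : ℝ × ℝ => ((s, q) : ℝ × ℝ × ℝ) := by fun_prop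
    exact hsol.continuousOn.comp hf.continuousOn fun q hq => ⟨mem_Ici.2 hs, hq⟩
  have hsup : ∀ σ, s₀ ≤ σ → ENNReal.ofReal (α / 9) ≤ ⨆ q : strip, ‖W σ q.1.1 q.1.2‖ₑ :=
    fun σ hσ => ofReal_le_iSup_of_decay hα hα1 hC₀ ha hC₀α hsmall hFcont hFa
      (hWcont σ (hs₀.trans hσ)) (mul_nonneg hC (Real.exp_pos _).le) (hdecay σ (hs₀.trans hσ))
      (hsmallC σ hσ)
  -- (3) the rescaled lower bound `α/9 ≤ λ(σ) N(t(σ))` for `σ ≥ s₀`, integrated up to `T_*`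
  have hm : ENNReal.ofReal (α / 9) ≠ 0 := (ENNReal.ofReal_pos.2 (by positivity)).ne'
  have hNle : ∀ σ, s₀ ≤ σ → ENNReal.ofReal (α / 9) ≤
      ENNReal.ofReal (lamE σ) * N (rescaledTime lamE σ) := by
    intro σ hσ
    have hσ0 : 0 ≤ σ := hs₀.trans hσ
    have hlamσ : 0 < lam σ := hsol.lam_pos σ hσ0
    rw [hlamE, extendNonneg_of_nonneg lam hσ0, rescaledTime_extendNonneg lam hσ0, hN σ hσ0,
      ← mul_assoc, ← ENNReal.ofReal_mul hlamσ.le, mul_inv_cancel₀ hlamσ.ne', ENNReal.ofReal_one,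
      one_mul]
    exact hsup σ hσ
  have hBKM := tendsto_lintegral_Ioo_nhdsLT_blowupTime_of_eventually hcontE hposE hintE hm hs₀ hNle
  rw [hTE] at hBKM
  exact ⟨hTpos, hBKM⟩

end Elgindi

/-! ### ns.S29 (i) for one small `α` -/

/-- **ns.S29 (i) from the stable modulated solution and its physical reading, for one small `α`**
(Elgindi–Ghoul–Masmoudi, Camb. J. Math. 9 (2021) = arXiv:1910.14071: §2.5 Thm 2 and Cor 2.2, §2.6,
read in the physical variables of §2.1–2.3 ⟹ §1.3 Thm 1, in the reviewed rendering
`elgindi_euler_blowup`). Hypotheses: the self-similar data of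
`Elgindi.bkmBlowup_of_physicalVorticity` for an exponent `0 < α ≤ 1` (§1.7, p. 5: "`α` will be
chosen at the end to be very small"), and physical fields `(u₀, u, p)` in the Hölder class
`IsHolderEulerSolution α [0, T_*) u₀ u p` (§1.3 Thm 1, p. 3: the class `L² ∩ C^{1,α}_{x,t}`),
`T_* = blowupTime λ = ∫₀^∞ λ`, with axisymmetric swirl-free slices (§2.1, p. 7; §2.6, p. 9: swirl
datum compactly supported — here zero) and the vorticity identity
`‖curl u(t(s))‖_{L^∞} = λ(s)⁻¹ sup_{strip}|W(s)|`, `t(s) = ∫₀ˢ λ` (§2.3, p. 8: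
`Ω(R,t,θ) = λ⁻¹W(μR/λ^{1+δ}, s, θ)`, `ds/dt = λ⁻¹`). Proof: the Beale–Kato–Majda divergence at
`T_* > 0` (`Elgindi.bkmBlowup_of_physicalVorticity`), then `elgindi_euler_blowup_of_bkmBlowupAt`
(the locally uniform `C^{1,α}` bounds of the class give the `limsup` form; the scaling
`u ↦ T_* u(T_* t, x)` normalises `T_* ↦ 1`). The datum clauses of Thm 1 (`u(0) = u₀ ∈ C^{1,α}`,
compactly supported vorticity) are carried by the class but not used by the target. [cite: ElgindiGhoulMasmoudi2021, §2.5 Thm 2, Cor 2.2 and Remark 2.3 (p. 9 of arXiv:1910.14071); §2.1–2.3 (p. 7–8); §1.3 Thm 1 (p. 3)] -/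
theorem elgindi_euler_blowup_of_physicalReading {α : ℝ≥0} {C₀ : ℝ} (hα : 0 < α) (hα1 : α ≤ 1)
    (hC₀ : 0 ≤ C₀) (hC₀α : C₀ * (α : ℝ) ≤ 1 / 2)
    (hsmall : C₀ * (α : ℝ) ≤ Real.sqrt (π / 6) / 18)
    {δ : ℝ} {F ΦF : ℝ → ℝ → ℝ} {a : ℝ} (hprof : Elgindi.IsProfile (α : ℝ) δ F ΦF)
    (ha : |a - 1| ≤ C₀ * (α : ℝ))
    (hFa : Elgindi.eHkNorm (α : ℝ) 0 (F - a • Elgindi.fundamentalProfile (α : ℝ)) ≤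
      ENNReal.ofReal (C₀ * (α : ℝ) ^ 2))
    {κ C : ℝ} (hκ : 0 < κ) (hC : 0 ≤ C) {W Φ : ℝ → ℝ → ℝ → ℝ} {lam mu : ℝ → ℝ}
    (hsol : Elgindi.IsModulatedSolution (α : ℝ) δ W Φ lam mu)
    (hdecay : ∀ s, 0 ≤ s →
      Elgindi.eHkNorm (α : ℝ) 0 (W s - F) ≤ ENNReal.ofReal (C * Real.exp (-κ * s)))
    (hint : IntegrableOn lam (Ioi 0))
    {u₀ : ℝ³ → ℝ³} {u : ℝ → ℝ³ → ℝ³} {p : ℝ → ℝ³ → ℝ}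
    (hHolder : IsHolderEulerSolution α (Ico 0 (blowupTime lam)) u₀ u p)
    (hsym : ∀ t ∈ Ico 0 (blowupTime lam), IsAxisymmetric (u t) ∧ HasNoSwirl (u t))
    (hvort : ∀ s, 0 ≤ s → FunctionSpaces.eSupNorm (curl (u (rescaledTime lam s))) =
      ENNReal.ofReal (lam s)⁻¹ * ⨆ q : Elgindi.strip, ‖W s q.1.1 q.1.2‖ₑ) :
    elgindi_euler_blowup := by
  have hαR : (0 : ℝ) < (α : ℝ) := NNReal.coe_pos.2 hα
  have hα1R : (α : ℝ) ≤ 1 := by exact_mod_cast hα1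
  obtain ⟨hTpos, hBKM⟩ := Elgindi.bkmBlowup_of_physicalVorticity hαR hα1R hC₀ hC₀α hsmall hprof ha
    hFa hκ hC hsol hdecay hint (N := fun t => FunctionSpaces.eSupNorm (curl (u t))) hvort
  refine elgindi_euler_blowup_of_bkmBlowupAt hα hTpos hHolder.euler (fun t ht => ?_)
    (fun T' hT' => hHolder.bound_of_lt hT') hBKM
  exact ⟨(hHolder.slice t ht).1, (hHolder.slice t ht).2.1, hsym t ht⟩

/-! ### ns.S29 (i) with the hypotheses packaged as printed (`∃ α₀ ∀ α < α₀`) and the choice of `α` -/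

/-- **ns.S29 (i) from the stable blow-up solution with its physical reading, packaged as printed**
(the printed §1.3 Theorem 1 of Elgindi–Ghoul–Masmoudi, Camb. J. Math. 9 (2021) =
arXiv:1910.14071, in the reviewed rendering `elgindi_euler_blowup`, blow-up time normalised
`T_* ↦ 1`). The hypothesis is the structure behind the printed theorem (§2.5 **Theorem 2**, p. 9
of the held text: "there exists `α₀ > 0` small so that for all `α < α₀`, there is a `δ₀ > 0` and
`κ > 0` so that for every initial `(ε₀, 𝒰₀^φ)` with `𝓔(ε₀, 𝒰₀^φ) < δ₀α^{3/2}` and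
`L₁₂(ε₀)(0) = 0`, there is an associated unique global solution … so that
`|μ_s| + |λ_s/λ + 1| + 𝓔(ε, 𝒰^φ)(s) ≤ C𝓔(ε₀, 𝒰₀^φ)e^{−κs}`"; **Cor. 2.2**: "there exists `T_*`";
**§2.6**, p. 9: the compactly supported datum, swirl datum zero; the profile `F = F_* + α²g`,
"`|g|_{𝓗ᵏ} ≤ C` with `C` a constant independent of `α`", §2.3, p. 7, after [Elgindi2021] §9.5)
read in the physical variables of §2.1–2.3, p. 7–8, in the class of §1.3 Thm 1, p. 3: for all
`0 < α < α₀` a profile close to `aF_*` in `𝓗⁰` with constants `C₀α`, `C₀α²`, a global swirl-free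
modulated solution launched by the compactly supported datum with the modulation estimate,
`‖W(s) − F‖_{𝓗⁰} ≤ Ce^{−κs}` and `λ ∈ L¹(0, ∞)`, and physical fields `(u₀, u, p)` in the Hölder
class on `[0, T_*)`, `T_* = ∫₀^∞ λ`, with the datum clauses of Thm 1 (`u₀ ∈ C^{1,α}` divergence
free with compactly supported vorticity, finite energy, axisymmetric without swirl),
axisymmetric swirl-free slices and the vorticity identity
`‖curl u(t(s))‖_{L^∞} = λ(s)⁻¹ sup|W(s)|` (until 2026-08-15 the named fact
`Elgindi.ElgindiGhoulMasmoudi2021_stableBlowupPhysical`, merged back under D-0026: its self-similar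
clauses are `Elgindi.stableModulatedSolution_of_core`, its physical ones the unformalised
dictionary). **Proof**: choose `α < α₀` with `α ≤ 1/2`, `C₁α ≤ 1/2`, `C₁α ≤ √(π/6)/18`,
`C₁ = max(C₀, 1)` (§1.7, p. 5) and apply `elgindi_euler_blowup_of_physicalReading`. [cite: ElgindiGhoulMasmoudi2021, §1.3 Thm 1 (p. 3); §2.5 Thm 2, Cor 2.2 and Remark 2.3 (p. 9 of arXiv:1910.14071); §2.6 (p. 9); §2.1–2.3 (p. 7–8)]
[cite: Elgindi2021, §9.5 (p. 34 of arXiv:1904.04795): the profile; §2 (p. 8): C^α solutions of the axisymmetric system are classical 3D Euler solutions] -/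
theorem elgindi_euler_blowup_of_stableBlowupPhysical
    (h : ∃ C₀ : ℝ, ∃ α₀ : ℝ≥0, 0 < α₀ ∧ ∀ α : ℝ≥0, 0 < α → α < α₀ →
      ∃ (δ : ℝ) (F ΦF : ℝ → ℝ → ℝ) (a : ℝ),
        Elgindi.IsProfile (α : ℝ) δ F ΦF ∧ |a - 1| ≤ C₀ * α ∧
        Elgindi.eHkNorm (α : ℝ) 0 (F - a • Elgindi.fundamentalProfile (α : ℝ)) ≤
          ENNReal.ofReal (C₀ * (α : ℝ) ^ 2) ∧
        ∃ κ C : ℝ, 0 < κ ∧ 0 < C ∧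
        ∃ (ε₀ : ℝ → ℝ → ℝ) (W Φ : ℝ → ℝ → ℝ → ℝ) (lam mu : ℝ → ℝ),
          Elgindi.IsModulatedSolution (α : ℝ) δ W Φ lam mu ∧ W 0 = F + ε₀ ∧ lam 0 = 1 ∧ mu 0 = 1 ∧
          (∃ M : ℝ, ∀ z θ, M ≤ z → θ ∈ Set.Icc 0 (π / 2) → F z θ + ε₀ z θ = 0) ∧
          (∀ s, 0 < s → |deriv mu s| + |deriv lam s / lam s + 1| ≤ C * Real.exp (-κ * s)) ∧
          (∀ s, 0 ≤ s →
            Elgindi.eHkNorm (α : ℝ) 0 (W s - F) ≤ ENNReal.ofReal (C * Real.exp (-κ * s))) ∧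
          IntegrableOn lam (Set.Ioi 0) ∧
          ∃ (u₀ : ℝ³ → ℝ³) (u : ℝ → ℝ³ → ℝ³) (p : ℝ → ℝ³ → ℝ),
            MemC1Holder α u₀ ∧ VectorCalculus.IsDivFree u₀ ∧ HasCompactSupport (curl u₀) ∧
            HasFiniteEnergy u₀ ∧ IsAxisymmetric u₀ ∧ HasNoSwirl u₀ ∧
            IsHolderEulerSolution α (Ico 0 (blowupTime lam)) u₀ u p ∧
            (∀ t ∈ Ico 0 (blowupTime lam), IsAxisymmetric (u t) ∧ HasNoSwirl (u t)) ∧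
            (∀ s, 0 ≤ s → FunctionSpaces.eSupNorm (curl (u (rescaledTime lam s))) =
              ENNReal.ofReal (lam s)⁻¹ * ⨆ q : Elgindi.strip, ‖W s q.1.1 q.1.2‖ₑ)) :
    elgindi_euler_blowup := by
  obtain ⟨C₀, α₀, hα₀, H⟩ := h
  -- (1) the choice of `α`
  set C₁ : ℝ := max C₀ 1 with hC₁
  have hC₁pos : 0 < C₁ := lt_of_lt_of_le one_pos (le_max_right _ _)
  have hC₀C₁ : C₀ ≤ C₁ := le_max_left _ _
  have hv : 0 < Real.sqrt (π / 6) := Real.sqrt_pos.2 (by positivity)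
  set αr : ℝ := min ((α₀ : ℝ) / 2) (min (1 / 2) (min (1 / (2 * C₁)) (Real.sqrt (π / 6) / (18 * C₁))))
    with hαr
  have hα₀r : (0 : ℝ) < α₀ := hα₀
  have hαr_pos : 0 < αr := by
    simp only [hαr, lt_min_iff]
    exact ⟨half_pos hα₀r, by norm_num, div_pos one_pos (mul_pos two_pos hC₁pos),
      div_pos hv (mul_pos (by norm_num) hC₁pos)⟩
  have hαr_le1 : αr ≤ α₀ / 2 := min_le_left _ _
  have hαr_le2 : αr ≤ 1 / 2 := (min_le_right _ _).trans (min_le_left _ _)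
  have hαr_le3 : αr ≤ 1 / (2 * C₁) :=
    (min_le_right _ _).trans ((min_le_right _ _).trans (min_le_left _ _))
  have hαr_le4 : αr ≤ Real.sqrt (π / 6) / (18 * C₁) :=
    (min_le_right _ _).trans ((min_le_right _ _).trans (min_le_right _ _))
  set α : ℝ≥0 := ⟨αr, hαr_pos.le⟩ with hαdef
  have hαcoe : (α : ℝ) = αr := rfl
  have hαpos : 0 < α := by
    rw [← NNReal.coe_pos, hαcoe]
    exact hαr_pos
  have hαlt : α < α₀ := by
    rw [← NNReal.coe_lt_coe, hαcoe]
    linarith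
  have hα1 : α ≤ 1 := by
    rw [← NNReal.coe_le_coe, NNReal.coe_one, hαcoe]
    linarith
  have hC₁α : C₁ * (α : ℝ) ≤ 1 / 2 := by
    rw [hαcoe]
    calc C₁ * αr ≤ C₁ * (1 / (2 * C₁)) := mul_le_mul_of_nonneg_left hαr_le3 hC₁pos.le
      _ = 1 / 2 := by field_simp
  have hsmall : C₁ * (α : ℝ) ≤ Real.sqrt (π / 6) / 18 := by
    rw [hαcoe]
    calc C₁ * αr ≤ C₁ * (Real.sqrt (π / 6) / (18 * C₁)) := mul_le_mul_of_nonneg_left hαr_le4 hC₁pos.le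
      _ = Real.sqrt (π / 6) / 18 := by field_simp
  -- (2) the stable blow-up solution for this `α`, with the profile constants weakened to `C₁`
  obtain ⟨δ, F, ΦF, a, hprof, ha, hFa, κ, C, hκ, hC, ε₀, W, Φ, lam, mu, hsol, -, -, -, -, -, hdecay,
    hint, u₀, u, p, -, -, -, -, -, -, hHolder, hsym, hvort⟩ :=
    H α hαpos hαlt
  have ha' : |a - 1| ≤ C₁ * (α : ℝ) :=
    ha.trans (mul_le_mul_of_nonneg_right hC₀C₁ (NNReal.coe_nonneg α))
  have hFa' : Elgindi.eHkNorm (α : ℝ) 0 (F - a • Elgindi.fundamentalProfile (α : ℝ)) ≤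
      ENNReal.ofReal (C₁ * (α : ℝ) ^ 2) :=
    hFa.trans (ENNReal.ofReal_le_ofReal (mul_le_mul_of_nonneg_right hC₀C₁ (sq_nonneg _)))
  -- (3) the target for this `α`
  exact elgindi_euler_blowup_of_physicalReading hαpos hα1 hC₁pos.le hC₁α hsmall hprof ha' hFa' hκ
    hC.le hsol hdecay hint hHolder hsym hvort

end Literature.Analysis.FluidPDE
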